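import Literature.NumberTheory.Rogawski1990.ArchHSBallVolumeProduct     -- ★ p848675 (LH3-p03): «places multiply», (T2-out) junction
import Literature.NumberTheory.Rogawski1990.ArchEllipticOrbitHSBall      -- ★ p848531 (LH3-p04): `hs_le_of_hs_conj_torusMatrix_le` (orbit HS-ball ⊆ group HS-ball of radius ≍ √R)
import Literature.NumberTheory.Rogawski1990.ArchPlaneHaarHSBallLocal    -- ★ p848722 (LH3-p02): «(T2-out)» UNCONDITIONAL `haar_unitaryGroupOfForm_antidiag_two_hsBall_le_linear`
import HarnessLib

/-!
# Volume growth of Hilbert–Schmidt balls along a totally ELLIPTIC regular orbit of `H_∞`: `ν_H{y ∣ archHSGL(ι_∞(y γ y⁻¹)) ≤ R} ≤ A R^{1∕2} (1 + log R)^m`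
# (the group side of `hvol` for the convergence of Schwartz orbital integrals; Beuzart-Plessis 2020 §1.8, §1.2 (1.2.2), (1.2.4); Harish-Chandra 1966 §9)

Topic `NumberTheory/Rogawski1990`; namespace `Literature.NumberTheory.Rogawski1990`.  THEOREMS ONLY (no definition, no instance, no notation, no axiom, no named fact,
no `sorry`).  Cell `pub/hodgecm-mathlib`, F0∕P3c line LH3 (crux H413 = `stmt-HodgeConjecture-24833`), organ (VOL) behind ★ (CONV) `integrable_descConj_of_archSchwartzGL_of_volumeGrowth`
(LH3-p04, p848470): its hypothesis `hvol` asks `μ{ẏ ∣ archHSGL(ι_∞(y γ y⁻¹)) ≤ R} ≤ A R^e (1 + log R)^m` with `e = 1∕2` on `H_∞`.  This file (LH3-p03, glue (VOL-ell-grp) offered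
2026-09-02) produces the GROUP-side bound for a `γ_H ∈ H_∞` that is REGULAR ELLIPTIC AT EVERY COMPLEX PLACE — `γ_{2,w} = g₀ · torusMatrix(λ₁, λ₂) · g₀⁻¹` in `U(Φ₂)_w ≅ U(1,1)`
with `λ₁ ≠ λ₂` (★ `torusMatrix`, the compact Cartan) — from the per-place LINEAR growth of Haar HS-balls in `U(1,1)` ((T2-out) of LH3-p02, taken as the hypothesis `hT2` in its
A-boxed text).  The passage to the Weil-form quotient `dν_H ∕ dt_H` by the compact centraliser `Z(γ_H)` is the consumer's (★ `lintegral_quotientMeasure_eq_inv_mul`); classes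
with a SPLIT (hyperbolic) place wait on (VOL-split).

THE MATHEMATICS.  Per place, for `Φ₂`-unitary `y`: ★ `hs_le_of_hs_conj_torusMatrix_le` (the rank-one identity of LH3-p04) gives `‖y g₀‖²_HS ≤ 2√(2ρ + 4|λ₂|²)∕|λ₁ − λ₂|`
whenever `‖(y g₀) T (y g₀)⁻¹‖²_HS ≤ ρ`; Hilbert–Schmidt is submultiplicative (`hs_mul_le`, 2 × 2 Cauchy–Schwarz), so `‖y‖²_HS ≤ ‖y g₀‖²_HS · ‖g₀⁻¹‖²_HS ≤ D_γ √ρ` — the orbit HS-ball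
of radius `ρ` lies in a GROUP HS-ball of radius `D_γ √ρ`, of Haar measure `≤ C · D_γ √ρ` by (T2-out) (★ `haar_hsWeight_succ_le_of_unitaryGroupOfForm`); no right-invariance of
the Haar measure is used.  Globally, `archHSGL(ι_∞(y γ y⁻¹)) = ∏_w (‖(y γ y⁻¹)_{2,w}‖²_HS + 1)` (★ `archHSGL_endoEmbArch`) and ★ `haar_setOf_prod_place_le_of_marginal_growth` («places
multiply», exponent `a = 1∕2`) assembles the places for ANY Haar measure on `H_∞`.

* §1 `norm_sq_two_term_le`, `hs_mul_le` (2 × 2 HS submultiplicativity), `hs_le_mul_of_hs_conj_le` (orbit ball ⊆ group ball, conjugated torus point);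
* §2 **`haar_setOf_hs_conj_le_of_elliptic`** (per place, `≤ C ρ^{1∕2}`), **`haar_setOf_archHSGL_conj_le_of_elliptic`** (`H_∞`, `≤ A R^{1∕2} (1 + log R)^m`), both over (T2-out) as a
  hypothesis `hT2`; §3 the UNCONDITIONAL forms `…_linear` (the hypothesis discharged by ★ `haar_unitaryGroupOfForm_antidiag_two_hsBall_le_linear`, LH3-p02 p848722) — the `hgrp`
  token of LH3-p04's (CONV-ell-final) at `e = 1∕2`.
HONEST LABEL: HC_CM is proved only modulo the 7 printed citations (2 remaining: hLiu418 = `stmt-HodgeConjecture-24832`, h413 = `stmt-HodgeConjecture-24833`) until rung 0 closes; this file is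
plumbing for the (VOL) organ (totally elliptic classes only) and pays no organ by itself.

## References
* [BeuzartPlessis2020Asterisque] R. Beuzart-Plessis, Astérisque 418 (2020), §1.8 p. 39; §1.2 (1.2.2), (1.2.4) p. 21.
* [HarishChandra1966] Harish-Chandra, *Discrete series for semisimple Lie groups II*, Acta Math. 116 (1966), §9.
* [Rogawski1990] J. D. Rogawski, Ann. of Math. Stud. 123 (1990), §3.6 p. 31 (the compact Cartan of `U(1,1)`), §4.6 Prop. 4.6.1, §14.3 p. 234.
-/

set_option autoImplicit false

noncomputable section

open MeasureTheory MeasureTheory.Measure Set Finset NumberField NumberField.InfinitePlace NumberField.mixedEmbedding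
open Literature.NumberTheory.Automorphic Literature.NumberTheory.Automorphic.UnitaryGroup
open scoped ENNReal NNReal MatrixGroups Matrix Classical ComplexConjugate

namespace Literature.NumberTheory.Rogawski1990

/-! ## §1 Hilbert–Schmidt algebra on `2 × 2` complex matrices -/

section HS

/-- Two-term Cauchy–Schwarz: `|p q + r s|² ≤ (|p|² + |r|²)(|q|² + |s|²)`. [folklore] [cite: BeuzartPlessis2020Asterisque, §1.2] -/
theorem norm_sq_two_term_le (p q r s : ℂ) : ‖p * q + r * s‖ ^ 2 ≤ (‖p‖ ^ 2 + ‖r‖ ^ 2) * (‖q‖ ^ 2 + ‖s‖ ^ 2) := by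
  have h1 : ‖p * q + r * s‖ ≤ ‖p‖ * ‖q‖ + ‖r‖ * ‖s‖ := by
    calc ‖p * q + r * s‖ ≤ ‖p * q‖ + ‖r * s‖ := norm_add_le _ _
      _ = ‖p‖ * ‖q‖ + ‖r‖ * ‖s‖ := by rw [norm_mul, norm_mul]
  have h0 : 0 ≤ ‖p * q + r * s‖ := norm_nonneg _
  nlinarith [sq_nonneg (‖p‖ * ‖s‖ - ‖r‖ * ‖q‖), norm_nonneg p, norm_nonneg q, norm_nonneg r, norm_nonneg s,
    mul_nonneg (norm_nonneg p) (norm_nonneg q), mul_nonneg (norm_nonneg r) (norm_nonneg s)]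

/-- **Hilbert–Schmidt is submultiplicative** on `2 × 2` complex matrices: `Σ|(AB)_{ij}|² ≤ (Σ|A_{ij}|²)(Σ|B_{ij}|²)`. [folklore] [cite: BeuzartPlessis2020Asterisque, §1.2] -/
theorem hs_mul_le (A B : Matrix (Fin 2) (Fin 2) ℂ) :
    ∑ i : Fin 2, ∑ j : Fin 2, ‖(A * B) i j‖ ^ 2 ≤ (∑ i : Fin 2, ∑ j : Fin 2, ‖A i j‖ ^ 2) * (∑ i : Fin 2, ∑ j : Fin 2, ‖B i j‖ ^ 2) := by
  have h : ∀ i j, ‖(A * B) i j‖ ^ 2 ≤ (‖A i 0‖ ^ 2 + ‖A i 1‖ ^ 2) * (‖B 0 j‖ ^ 2 + ‖B 1 j‖ ^ 2) := fun i j => by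
    rw [Matrix.mul_apply, Fin.sum_univ_two]
    exact norm_sq_two_term_le _ _ _ _
  simp only [Fin.sum_univ_two]
  have h00 := h 0 0
  have h01 := h 0 1
  have h10 := h 1 0
  have h11 := h 1 1
  calc ‖(A * B) 0 0‖ ^ 2 + ‖(A * B) 0 1‖ ^ 2 + (‖(A * B) 1 0‖ ^ 2 + ‖(A * B) 1 1‖ ^ 2)
      ≤ (‖A 0 0‖ ^ 2 + ‖A 0 1‖ ^ 2) * (‖B 0 0‖ ^ 2 + ‖B 1 0‖ ^ 2) + (‖A 0 0‖ ^ 2 + ‖A 0 1‖ ^ 2) * (‖B 0 1‖ ^ 2 + ‖B 1 1‖ ^ 2) +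
        ((‖A 1 0‖ ^ 2 + ‖A 1 1‖ ^ 2) * (‖B 0 0‖ ^ 2 + ‖B 1 0‖ ^ 2) + (‖A 1 0‖ ^ 2 + ‖A 1 1‖ ^ 2) * (‖B 0 1‖ ^ 2 + ‖B 1 1‖ ^ 2)) := by
        linarith
    _ = (‖A 0 0‖ ^ 2 + ‖A 0 1‖ ^ 2 + (‖A 1 0‖ ^ 2 + ‖A 1 1‖ ^ 2)) * (‖B 0 0‖ ^ 2 + ‖B 0 1‖ ^ 2 + (‖B 1 0‖ ^ 2 + ‖B 1 1‖ ^ 2)) := by ring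

/-- **ORBIT HS-BALL ⊆ GROUP HS-BALL for a conjugated compact-torus point.**  For `Φ₂`-unitary `y` and `g₀` with `g₀` invertible and `y g₀` `Φ₂`-unitary: if
`‖y (g₀ T g₀⁻¹) y⁻¹‖²_HS ≤ ρ` with `T = torusMatrix λ₁ λ₂`, `λ₁ ≠ λ₂`, then `‖y‖²_HS ≤ (2√(2ρ + 4|λ₂|²)∕|λ₁ − λ₂|) · ‖g₀⁻¹‖²_HS` (★ `hs_le_of_hs_conj_torusMatrix_le` at `y g₀`, then
`y = (y g₀) g₀⁻¹` and `hs_mul_le`). [cite: BeuzartPlessis2020Asterisque, §1.8 p. 39; §1.2 (1.2.2), (1.2.4) p. 21] [cite: Rogawski1990, §4.6 Prop. 4.6.1] -/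
theorem hs_le_mul_of_hs_conj_le {y g₀ : Matrix (Fin 2) (Fin 2) ℂ} (hg₀ : IsUnit g₀.det)
    (hyg : ((y * g₀).map (starRingEnd ℂ))ᵀ * (Matrix.of fun i j : Fin 2 => if i.val + j.val + 1 = 2 then (1 : ℂ) else 0) * (y * g₀) =
      Matrix.of fun i j : Fin 2 => if i.val + j.val + 1 = 2 then (1 : ℂ) else 0)
    {l₁ l₂ : ℂ} (hne : l₁ ≠ l₂) {ρ : ℝ}
    (hρ : ∑ i : Fin 2, ∑ j : Fin 2, ‖(y * (g₀ * torusMatrix l₁ l₂ * g₀⁻¹) * y⁻¹) i j‖ ^ 2 ≤ ρ) :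
    ∑ i : Fin 2, ∑ j : Fin 2, ‖y i j‖ ^ 2 ≤ 2 * Real.sqrt (2 * ρ + 4 * ‖l₂‖ ^ 2) / ‖l₁ - l₂‖ * ∑ i : Fin 2, ∑ j : Fin 2, ‖g₀⁻¹ i j‖ ^ 2 := by
  -- `y` is invertible (it is a factor of the invertible `y g₀`)
  have hJdet : (Matrix.of fun i j : Fin 2 => if i.val + j.val + 1 = 2 then (1 : ℂ) else 0).det = -1 := by
    rw [Matrix.det_fin_two]; simp [Matrix.of_apply]
  have hygdet : IsUnit (y * g₀).det := by
    have h := congrArg Matrix.det hyg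
    rw [Matrix.det_mul, Matrix.det_mul, hJdet] at h
    -- det((yg₀)ᴴ) * (-1) * det(yg₀) = -1 ⇒ det(yg₀) ≠ 0
    refine isUnit_iff_ne_zero.2 fun h0 => ?_
    rw [h0, mul_zero] at h
    norm_num at h
  have hydet : IsUnit y.det := by
    rw [Matrix.det_mul] at hygdet
    exact isUnit_of_mul_isUnit_left hygdet
  -- rewrite the conjugate through `y g₀`
  have hconj : y * (g₀ * torusMatrix l₁ l₂ * g₀⁻¹) * y⁻¹ = (y * g₀) * torusMatrix l₁ l₂ * (y * g₀)⁻¹ := by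
    rw [Matrix.mul_inv_rev]
    simp only [Matrix.mul_assoc]
  rw [hconj] at hρ
  have h1 := hs_le_of_hs_conj_torusMatrix_le hyg hne hρ
  -- `y = (y g₀) g₀⁻¹`
  have hy : y = (y * g₀) * g₀⁻¹ := by rw [Matrix.mul_assoc, Matrix.mul_nonsing_inv _ hg₀, Matrix.mul_one]
  have h2 := hs_mul_le (y * g₀) g₀⁻¹
  rw [← hy] at h2
  have hK0 : 0 ≤ ∑ i : Fin 2, ∑ j : Fin 2, ‖g₀⁻¹ i j‖ ^ 2 := Finset.sum_nonneg fun _ _ => Finset.sum_nonneg fun _ _ => by positivity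
  exact h2.trans (mul_le_mul_of_nonneg_right h1 hK0)

end HS

/-! ## §2 The volume growth along a totally elliptic regular orbit -/

section Elliptic

variable (L : Type) [Field L] [NumberField L] [IsCMField L]

omit [NumberField L] [IsCMField L] in
/-- **PER PLACE: the orbit HS-balls of a regular ELLIPTIC class have Haar measure `≤ C ρ^{1∕2}`.**  For every Haar measure `ν` on `U(Φ₂)_w` (★ `archLocal`), every `γ, g₀ ∈ U(Φ₂)_w` with
`γ = g₀ · torusMatrix(λ₁, λ₂) · g₀⁻¹`, `λ₁ ≠ λ₂`, and given the linear growth of Haar HS-balls in `U(1,1)` ((T2-out), hypothesis `hT2`):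
`ν{y ∣ ‖y γ y⁻¹‖²_HS + 1 ≤ ρ} ≤ C ρ^{1∕2}` for `ρ ≥ 1` (§1: the set lies in the group HS-ball of radius `D_γ √ρ`; ★ `haar_hsWeight_succ_le_of_unitaryGroupOfForm`).
[cite: BeuzartPlessis2020Asterisque, §1.8 p. 39; §1.2 (1.2.2), (1.2.4) p. 21] [cite: Rogawski1990, §3.6 p. 31] -/
theorem haar_setOf_hs_conj_le_of_elliptic (w : {w : InfinitePlace L // w.IsComplex})
    (hT2 : ∀ [MeasurableSpace ↥(unitaryGroupOfForm (starRingEnd ℂ) (Matrix.of fun i j : Fin 2 => if i.val + j.val + 1 = 2 then (1 : ℂ) else 0))]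
      [BorelSpace ↥(unitaryGroupOfForm (starRingEnd ℂ) (Matrix.of fun i j : Fin 2 => if i.val + j.val + 1 = 2 then (1 : ℂ) else 0))]
      (ν : Measure ↥(unitaryGroupOfForm (starRingEnd ℂ) (Matrix.of fun i j : Fin 2 => if i.val + j.val + 1 = 2 then (1 : ℂ) else 0))) [ν.IsHaarMeasure],
      ∃ C : ℝ, ∀ ρ : ℝ, 2 ≤ ρ → ν {g | ∑ i : Fin 2, ∑ j : Fin 2, ‖((g : GL (Fin 2) ℂ) : Matrix (Fin 2) (Fin 2) ℂ) i j‖ ^ 2 ≤ ρ} ≤ ENNReal.ofReal (C * ρ))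
    [MeasurableSpace ↥(archLocal L 2 (Matrix.of fun i j : Fin 2 => if i.val + j.val + 1 = 2 then (1 : L) else 0) w)]
    [BorelSpace ↥(archLocal L 2 (Matrix.of fun i j : Fin 2 => if i.val + j.val + 1 = 2 then (1 : L) else 0) w)]
    (ν : Measure ↥(archLocal L 2 (Matrix.of fun i j : Fin 2 => if i.val + j.val + 1 = 2 then (1 : L) else 0) w)) [ν.IsHaarMeasure]
    (γ g₀ : ↥(archLocal L 2 (Matrix.of fun i j : Fin 2 => if i.val + j.val + 1 = 2 then (1 : L) else 0) w)) {l₁ l₂ : ℂ} (hne : l₁ ≠ l₂)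
    (hγ : (((γ : GL (Fin 2) ℂ)) : Matrix (Fin 2) (Fin 2) ℂ) =
      ((g₀ : GL (Fin 2) ℂ) : Matrix (Fin 2) (Fin 2) ℂ) * torusMatrix l₁ l₂ * (((g₀ : GL (Fin 2) ℂ)) : Matrix (Fin 2) (Fin 2) ℂ)⁻¹) :
    ∃ C : ℝ, ∀ ρ : ℝ, 1 ≤ ρ →
      ν {y | ∑ i : Fin 2, ∑ j : Fin 2, ‖(((y * γ * y⁻¹ : ↥(archLocal L 2 (Matrix.of fun i j : Fin 2 => if i.val + j.val + 1 = 2 then (1 : L) else 0) w)) :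
          GL (Fin 2) ℂ) : Matrix (Fin 2) (Fin 2) ℂ) i j‖ ^ 2 + 1 ≤ ρ} ≤ ENNReal.ofReal (C * ρ ^ (1 / (2 : ℝ))) := by
  classical
  have heq : archLocal L 2 (Matrix.of fun i j : Fin 2 => if i.val + j.val + 1 = 2 then (1 : L) else 0) w =
      unitaryGroupOfForm (starRingEnd ℂ) (Matrix.of fun i j : Fin 2 => if i.val + j.val + 1 = 2 then (1 : ℂ) else 0) := by
    unfold archLocal; rw [antidiagOne_map]
  -- the group HS-ball bound from (T2-out)
  obtain ⟨C, hC⟩ := haar_hsWeight_succ_le_of_unitaryGroupOfForm L w hT2 ν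
  -- the constants of the class
  set K : ℝ := ∑ i : Fin 2, ∑ j : Fin 2, ‖((((g₀ : GL (Fin 2) ℂ)) : Matrix (Fin 2) (Fin 2) ℂ)⁻¹) i j‖ ^ 2 with hK
  have hK0 : 0 ≤ K := Finset.sum_nonneg fun _ _ => Finset.sum_nonneg fun _ _ => by positivity
  set E : ℝ := 2 * Real.sqrt (2 + 4 * ‖l₂‖ ^ 2) / ‖l₁ - l₂‖ with hE
  have hE0 : 0 ≤ E := div_nonneg (mul_nonneg zero_le_two (Real.sqrt_nonneg _)) (norm_nonneg _)
  set D : ℝ := E * K + 1 with hD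
  have hD0 : 0 ≤ D := by positivity
  refine ⟨max C 0 * D, fun ρ hρ => ?_⟩
  have hρ0 : 0 ≤ ρ := zero_le_one.trans hρ
  have hsqrt1 : 1 ≤ Real.sqrt ρ := by rw [← Real.sqrt_one]; exact Real.sqrt_le_sqrt hρ
  -- inclusion into the group HS-ball of radius `E K √ρ`, i.e. `HS + 1 ≤ D √ρ`
  have hsub : {y : ↥(archLocal L 2 (Matrix.of fun i j : Fin 2 => if i.val + j.val + 1 = 2 then (1 : L) else 0) w) |
        ∑ i : Fin 2, ∑ j : Fin 2, ‖(((y * γ * y⁻¹ : ↥(archLocal L 2 _ w)) : GL (Fin 2) ℂ) : Matrix (Fin 2) (Fin 2) ℂ) i j‖ ^ 2 + 1 ≤ ρ} ⊆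
      {y | ∑ i : Fin 2, ∑ j : Fin 2, ‖((y : GL (Fin 2) ℂ) : Matrix (Fin 2) (Fin 2) ℂ) i j‖ ^ 2 + 1 ≤ D * Real.sqrt ρ} := by
    intro y hy
    have hy' : ∑ i : Fin 2, ∑ j : Fin 2, ‖(((y * γ * y⁻¹ : ↥(archLocal L 2 _ w)) : GL (Fin 2) ℂ) : Matrix (Fin 2) (Fin 2) ℂ) i j‖ ^ 2 + 1 ≤ ρ := hy
    -- unitarity of `y g₀`
    have hmem : (y : GL (Fin 2) ℂ) * (g₀ : GL (Fin 2) ℂ) ∈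
        unitaryGroupOfForm (starRingEnd ℂ) (Matrix.of fun i j : Fin 2 => if i.val + j.val + 1 = 2 then (1 : ℂ) else 0) := by
      rw [← heq]
      exact (y * g₀).2
    have hyg' : ((((y : GL (Fin 2) ℂ) : Matrix (Fin 2) (Fin 2) ℂ) * ((g₀ : GL (Fin 2) ℂ) : Matrix (Fin 2) (Fin 2) ℂ)).map (starRingEnd ℂ))ᵀ *
        (Matrix.of fun i j : Fin 2 => if i.val + j.val + 1 = 2 then (1 : ℂ) else 0) *
        (((y : GL (Fin 2) ℂ) : Matrix (Fin 2) (Fin 2) ℂ) * ((g₀ : GL (Fin 2) ℂ) : Matrix (Fin 2) (Fin 2) ℂ)) =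
        Matrix.of fun i j : Fin 2 => if i.val + j.val + 1 = 2 then (1 : ℂ) else 0 := by
      have h := mem_unitaryGroupOfForm_iff.1 hmem
      rw [Units.val_mul] at h
      exact h
    -- the conjugate as matrices
    have hmat : (((y * γ * y⁻¹ : ↥(archLocal L 2 _ w)) : GL (Fin 2) ℂ) : Matrix (Fin 2) (Fin 2) ℂ) =
        ((y : GL (Fin 2) ℂ) : Matrix (Fin 2) (Fin 2) ℂ) * (((g₀ : GL (Fin 2) ℂ) : Matrix (Fin 2) (Fin 2) ℂ) * torusMatrix l₁ l₂ *
          (((g₀ : GL (Fin 2) ℂ)) : Matrix (Fin 2) (Fin 2) ℂ)⁻¹) * (((y : GL (Fin 2) ℂ)) : Matrix (Fin 2) (Fin 2) ℂ)⁻¹ := by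
      rw [← hγ, Subgroup.coe_mul, Subgroup.coe_mul, Subgroup.coe_inv, Units.val_mul, Units.val_mul, Matrix.coe_units_inv]
    rw [hmat] at hy'
    have hg₀ : IsUnit (((g₀ : GL (Fin 2) ℂ) : Matrix (Fin 2) (Fin 2) ℂ)).det := (Matrix.isUnits_det_units _)
    have h1 := hs_le_mul_of_hs_conj_le hg₀ hyg' hne (ρ := ρ - 1) (by linarith)
    -- `2√(2(ρ-1) + 4|λ₂|²)/|λ₁-λ₂| ≤ E √ρ`
    have hroot : 2 * Real.sqrt (2 * (ρ - 1) + 4 * ‖l₂‖ ^ 2) / ‖l₁ - l₂‖ ≤ E * Real.sqrt ρ := by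
      rw [hE, div_mul_eq_mul_div, mul_assoc, ← Real.sqrt_mul (by positivity)]
      refine div_le_div_of_nonneg_right (mul_le_mul_of_nonneg_left (Real.sqrt_le_sqrt (by nlinarith [norm_nonneg l₂])) zero_le_two) (norm_nonneg _)
    have h2 : ∑ i : Fin 2, ∑ j : Fin 2, ‖((y : GL (Fin 2) ℂ) : Matrix (Fin 2) (Fin 2) ℂ) i j‖ ^ 2 ≤ E * K * Real.sqrt ρ := by
      calc _ ≤ 2 * Real.sqrt (2 * (ρ - 1) + 4 * ‖l₂‖ ^ 2) / ‖l₁ - l₂‖ * K := h1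
        _ ≤ E * Real.sqrt ρ * K := mul_le_mul_of_nonneg_right hroot hK0
        _ = E * K * Real.sqrt ρ := by ring
    show ∑ i : Fin 2, ∑ j : Fin 2, ‖((y : GL (Fin 2) ℂ) : Matrix (Fin 2) (Fin 2) ℂ) i j‖ ^ 2 + 1 ≤ D * Real.sqrt ρ
    rw [hD]
    nlinarith
  have hDρ : 1 ≤ D * Real.sqrt ρ := by nlinarith [mul_nonneg (mul_nonneg hE0 hK0) (Real.sqrt_nonneg ρ)]
  calc ν {y | ∑ i : Fin 2, ∑ j : Fin 2, ‖(((y * γ * y⁻¹ : ↥(archLocal L 2 _ w)) : GL (Fin 2) ℂ) : Matrix (Fin 2) (Fin 2) ℂ) i j‖ ^ 2 + 1 ≤ ρ}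
      ≤ ν {y | ∑ i : Fin 2, ∑ j : Fin 2, ‖((y : GL (Fin 2) ℂ) : Matrix (Fin 2) (Fin 2) ℂ) i j‖ ^ 2 + 1 ≤ D * Real.sqrt ρ} := measure_mono hsub
    _ ≤ ENNReal.ofReal (C * (D * Real.sqrt ρ) ^ (1 : ℝ)) := hC _ hDρ
    _ ≤ ENNReal.ofReal (max C 0 * D * ρ ^ (1 / (2 : ℝ))) := by
        rw [Real.rpow_one, ← Real.sqrt_eq_rpow]
        refine ENNReal.ofReal_le_ofReal ?_
        have : C * (D * Real.sqrt ρ) ≤ max C 0 * (D * Real.sqrt ρ) := mul_le_mul_of_nonneg_right (le_max_left _ _) (by positivity)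
        linarith

/-- **ON `H_∞`: the HS-balls along a TOTALLY ELLIPTIC regular orbit grow like `R^{1∕2} (1 + log R)^m`** (group side of `hvol`): for every Haar measure `ν_H` on
`H_∞ = U(Φ₂)(L⁺ ⊗ ℝ) × U(Φ₁)(L⁺ ⊗ ℝ)` and every `γ_H` whose `U(Φ₂)`-component is, at EVERY complex place, a `U(Φ₂)_w`-conjugate of a regular compact-torus point
`torusMatrix(λ₁, λ₂)` (`λ₁ ≠ λ₂`): `ν_H{y ∣ archHSGL(ι_∞(y γ_H y⁻¹)) ≤ R} ≤ A R^{1∕2} (1 + log R)^m` for `R ≥ 1` (★ `archHSGL_endoEmbArch`; per place `haar_setOf_hs_conj_le_of_elliptic`;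
★ «places multiply» with `a = 1∕2`). [cite: BeuzartPlessis2020Asterisque, §1.8 p. 39; §1.2 (1.2.2), (1.2.4) p. 21] [cite: HarishChandra1966, §9] [cite: Rogawski1990, §14.3 p. 234] -/
theorem haar_setOf_archHSGL_conj_le_of_elliptic
    (hT2 : ∀ [MeasurableSpace ↥(unitaryGroupOfForm (starRingEnd ℂ) (Matrix.of fun i j : Fin 2 => if i.val + j.val + 1 = 2 then (1 : ℂ) else 0))]
      [BorelSpace ↥(unitaryGroupOfForm (starRingEnd ℂ) (Matrix.of fun i j : Fin 2 => if i.val + j.val + 1 = 2 then (1 : ℂ) else 0))]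
      (ν : Measure ↥(unitaryGroupOfForm (starRingEnd ℂ) (Matrix.of fun i j : Fin 2 => if i.val + j.val + 1 = 2 then (1 : ℂ) else 0))) [ν.IsHaarMeasure],
      ∃ C : ℝ, ∀ ρ : ℝ, 2 ≤ ρ → ν {g | ∑ i : Fin 2, ∑ j : Fin 2, ‖((g : GL (Fin 2) ℂ) : Matrix (Fin 2) (Fin 2) ℂ) i j‖ ^ 2 ≤ ρ} ≤ ENNReal.ofReal (C * ρ))
    [MeasurableSpace ((↥(UnitaryGroup.arch (↥(maximalRealSubfield L)) L (IsCMField.complexConj L) 2 (Matrix.of fun i j : Fin 2 => if i.val + j.val + 1 = 2 then (1 : L) else 0)) ×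
      ↥(UnitaryGroup.arch (↥(maximalRealSubfield L)) L (IsCMField.complexConj L) 1 (Matrix.of fun i j : Fin 1 => if i.val + j.val + 1 = 1 then (1 : L) else 0))))]
    [BorelSpace ((↥(UnitaryGroup.arch (↥(maximalRealSubfield L)) L (IsCMField.complexConj L) 2 (Matrix.of fun i j : Fin 2 => if i.val + j.val + 1 = 2 then (1 : L) else 0)) ×
      ↥(UnitaryGroup.arch (↥(maximalRealSubfield L)) L (IsCMField.complexConj L) 1 (Matrix.of fun i j : Fin 1 => if i.val + j.val + 1 = 1 then (1 : L) else 0))))]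
    (νH : Measure ((↥(UnitaryGroup.arch (↥(maximalRealSubfield L)) L (IsCMField.complexConj L) 2 (Matrix.of fun i j : Fin 2 => if i.val + j.val + 1 = 2 then (1 : L) else 0)) ×
      ↥(UnitaryGroup.arch (↥(maximalRealSubfield L)) L (IsCMField.complexConj L) 1 (Matrix.of fun i j : Fin 1 => if i.val + j.val + 1 = 1 then (1 : L) else 0)))))
    [νH.IsHaarMeasure]
    (γ : (↥(UnitaryGroup.arch (↥(maximalRealSubfield L)) L (IsCMField.complexConj L) 2 (Matrix.of fun i j : Fin 2 => if i.val + j.val + 1 = 2 then (1 : L) else 0)) ×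
      ↥(UnitaryGroup.arch (↥(maximalRealSubfield L)) L (IsCMField.complexConj L) 1 (Matrix.of fun i j : Fin 1 => if i.val + j.val + 1 = 1 then (1 : L) else 0))))
    (hell : ∀ w : {w : InfinitePlace L // w.IsComplex},
      ∃ (g₀ : ↥(archLocal L 2 (Matrix.of fun i j : Fin 2 => if i.val + j.val + 1 = 2 then (1 : L) else 0) w)) (l₁ l₂ : ℂ), l₁ ≠ l₂ ∧
        (((archPiEquivCM 2 L (Matrix.of fun i j : Fin 2 => if i.val + j.val + 1 = 2 then (1 : L) else 0) γ.1 w :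
            ↥(archLocal L 2 (Matrix.of fun i j : Fin 2 => if i.val + j.val + 1 = 2 then (1 : L) else 0) w)) : GL (Fin 2) ℂ) : Matrix (Fin 2) (Fin 2) ℂ) =
          ((g₀ : GL (Fin 2) ℂ) : Matrix (Fin 2) (Fin 2) ℂ) * torusMatrix l₁ l₂ * (((g₀ : GL (Fin 2) ℂ)) : Matrix (Fin 2) (Fin 2) ℂ)⁻¹) :
    ∃ (A : ℝ) (m : ℕ), ∀ R : ℝ, 1 ≤ R →
      νH {y | archHSGL L 3 ((endoEmbArch L (y * γ * y⁻¹)).val : GL (Fin 3) (mixedSpace L)) ≤ R} ≤ ENNReal.ofReal (A * R ^ (1 / (2 : ℝ)) * (1 + Real.log R) ^ m) := by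
  classical
  letI mU : ∀ w : {w : InfinitePlace L // w.IsComplex},
      MeasurableSpace ↥(archLocal L 2 (Matrix.of fun i j : Fin 2 => if i.val + j.val + 1 = 2 then (1 : L) else 0) w) := fun _ => borel _
  haveI : ∀ w : {w : InfinitePlace L // w.IsComplex},
      BorelSpace ↥(archLocal L 2 (Matrix.of fun i j : Fin 2 => if i.val + j.val + 1 = 2 then (1 : L) else 0) w) := fun _ => ⟨rfl⟩
  set e := archPiEquivCM 2 L (Matrix.of fun i j : Fin 2 => if i.val + j.val + 1 = 2 then (1 : L) else 0) with he
  choose g₀ l₁ l₂ hne hγ using hell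
  obtain ⟨A, m, hA⟩ := haar_setOf_prod_place_le_of_marginal_growth L νH
    (fun w (y : ↥(archLocal L 2 (Matrix.of fun i j : Fin 2 => if i.val + j.val + 1 = 2 then (1 : L) else 0) w)) =>
      ∑ i : Fin 2, ∑ j : Fin 2, ‖(((y * e γ.1 w * y⁻¹ : ↥(archLocal L 2 _ w)) : GL (Fin 2) ℂ) : Matrix (Fin 2) (Fin 2) ℂ) i j‖ ^ 2 + 1)
    (fun w y => by
      have : (0 : ℝ) ≤ ∑ i : Fin 2, ∑ j : Fin 2, ‖(((y * e γ.1 w * y⁻¹ : ↥(archLocal L 2 _ w)) : GL (Fin 2) ℂ) : Matrix (Fin 2) (Fin 2) ℂ) i j‖ ^ 2 :=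
        Finset.sum_nonneg fun _ _ => Finset.sum_nonneg fun _ _ => by positivity
      linarith)
    (a := 1 / (2 : ℝ)) (by norm_num)
    (fun w ν _ => haar_setOf_hs_conj_le_of_elliptic L w hT2 ν (e γ.1 w) (g₀ w) (hne w) (hγ w))
  refine ⟨A, m, fun R hR => ?_⟩
  have hset : {y : (↥(UnitaryGroup.arch (↥(maximalRealSubfield L)) L (IsCMField.complexConj L) 2 (Matrix.of fun i j : Fin 2 => if i.val + j.val + 1 = 2 then (1 : L) else 0)) ×
      ↥(UnitaryGroup.arch (↥(maximalRealSubfield L)) L (IsCMField.complexConj L) 1 (Matrix.of fun i j : Fin 1 => if i.val + j.val + 1 = 1 then (1 : L) else 0))) |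
        archHSGL L 3 ((endoEmbArch L (y * γ * y⁻¹)).val : GL (Fin 3) (mixedSpace L)) ≤ R} =
      {y | ∏ w, (∑ i : Fin 2, ∑ j : Fin 2, ‖((((e y.1 w) * e γ.1 w * (e y.1 w)⁻¹ : ↥(archLocal L 2 _ w)) : GL (Fin 2) ℂ) : Matrix (Fin 2) (Fin 2) ℂ) i j‖ ^ 2 + 1) ≤ R} := by
    ext y
    rw [Set.mem_setOf_eq, Set.mem_setOf_eq, archHSGL_endoEmbArch]
    have hcomp : ∀ w, e (y * γ * y⁻¹).1 w = e y.1 w * e γ.1 w * (e y.1 w)⁻¹ := fun w => by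
      rw [Prod.fst_mul, Prod.fst_mul, Prod.fst_inv, map_mul, map_mul, map_inv, Pi.mul_apply, Pi.mul_apply, Pi.inv_apply]
    simp_rw [← hcomp]
    rfl
  rw [hset]
  exact hA R hR

/-! ## §3 UNCONDITIONAL forms ((T2-out) is ★ `haar_unitaryGroupOfForm_antidiag_two_hsBall_le_linear`) -/

omit [NumberField L] [IsCMField L] in
/-- **PER PLACE, UNCONDITIONAL**: for every Haar `ν` on `U(Φ₂)_w` and every regular elliptic `γ = g₀ · torusMatrix(λ₁, λ₂) · g₀⁻¹` (`λ₁ ≠ λ₂`),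
`ν{y ∣ ‖y γ y⁻¹‖²_HS + 1 ≤ ρ} ≤ C ρ^{1∕2}` for `ρ ≥ 1`. [cite: BeuzartPlessis2020Asterisque, §1.8 p. 39; §1.2 (1.2.2), (1.2.4) p. 21] [cite: Rogawski1990, §3.6 p. 31] -/
theorem haar_setOf_hs_conj_le_of_elliptic_linear (w : {w : InfinitePlace L // w.IsComplex})
    [MeasurableSpace ↥(archLocal L 2 (Matrix.of fun i j : Fin 2 => if i.val + j.val + 1 = 2 then (1 : L) else 0) w)] [BorelSpace ↥(archLocal L 2 (Matrix.of fun i j : Fin 2 => if i.val + j.val + 1 = 2 then (1 : L) else 0) w)] (ν : Measure ↥(archLocal L 2 (Matrix.of fun i j : Fin 2 => if i.val + j.val + 1 = 2 then (1 : L) else 0) w)) [ν.IsHaarMeasure]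
    (γ g₀ : ↥(archLocal L 2 (Matrix.of fun i j : Fin 2 => if i.val + j.val + 1 = 2 then (1 : L) else 0) w)) {l₁ l₂ : ℂ} (hne : l₁ ≠ l₂)
    (hγ : (((γ : GL (Fin 2) ℂ)) : Matrix (Fin 2) (Fin 2) ℂ) =
      ((g₀ : GL (Fin 2) ℂ) : Matrix (Fin 2) (Fin 2) ℂ) * torusMatrix l₁ l₂ * (((g₀ : GL (Fin 2) ℂ)) : Matrix (Fin 2) (Fin 2) ℂ)⁻¹) :
    ∃ C : ℝ, ∀ ρ : ℝ, 1 ≤ ρ →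
      ν {y | ∑ i : Fin 2, ∑ j : Fin 2, ‖(((y * γ * y⁻¹ : ↥(archLocal L 2 (Matrix.of fun i j : Fin 2 => if i.val + j.val + 1 = 2 then (1 : L) else 0) w)) : GL (Fin 2) ℂ) : Matrix (Fin 2) (Fin 2) ℂ) i j‖ ^ 2 + 1 ≤ ρ} ≤
        ENNReal.ofReal (C * ρ ^ (1 / (2 : ℝ))) :=
  haar_setOf_hs_conj_le_of_elliptic L w (fun ν _ => haar_unitaryGroupOfForm_antidiag_two_hsBall_le_linear ν) ν γ g₀ hne hγ

/-- **ON `H_∞`, UNCONDITIONAL — the `hgrp` token of (CONV-ell-final) at `e = 1∕2`**: for every Haar measure `ν_H` on `H_∞` and every `γ_H` regular elliptic at every complex place,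
`ν_H{y ∣ archHSGL(ι_∞(y γ_H y⁻¹)) ≤ R} ≤ A R^{1∕2} (1 + log R)^m` for `R ≥ 1`. [cite: BeuzartPlessis2020Asterisque, §1.8 p. 39; §1.2 (1.2.2), (1.2.4) p. 21] [cite: HarishChandra1966, §9]
[cite: Rogawski1990, §14.3 p. 234] -/
theorem haar_setOf_archHSGL_conj_le_of_elliptic_linear
    [MeasurableSpace (↥(UnitaryGroup.arch (↥(maximalRealSubfield L)) L (IsCMField.complexConj L) 2 (Matrix.of fun i j : Fin 2 => if i.val + j.val + 1 = 2 then (1 : L) else 0)) × ↥(UnitaryGroup.arch (↥(maximalRealSubfield L)) L (IsCMField.complexConj L) 1 (Matrix.of fun i j : Fin 1 => if i.val + j.val + 1 = 1 then (1 : L) else 0)))] [BorelSpace (↥(UnitaryGroup.arch (↥(maximalRealSubfield L)) L (IsCMField.complexConj L) 2 (Matrix.of fun i j : Fin 2 => if i.val + j.val + 1 = 2 then (1 : L) else 0)) × ↥(UnitaryGroup.arch (↥(maximalRealSubfield L)) L (IsCMField.complexConj L) 1 (Matrix.of fun i j : Fin 1 => if i.val + j.val + 1 = 1 then (1 : L)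 else 0)))]
    (νH : Measure (↥(UnitaryGroup.arch (↥(maximalRealSubfield L)) L (IsCMField.complexConj L) 2 (Matrix.of fun i j : Fin 2 => if i.val + j.val + 1 = 2 then (1 : L) else 0)) × ↥(UnitaryGroup.arch (↥(maximalRealSubfield L)) L (IsCMField.complexConj L) 1 (Matrix.of fun i j : Fin 1 => if i.val + j.val + 1 = 1 then (1 : L) else 0)))) [νH.IsHaarMeasure]
    (γ : ↥(UnitaryGroup.arch (↥(maximalRealSubfield L)) L (IsCMField.complexConj L) 2 (Matrix.of fun i j : Fin 2 => if i.val + j.val + 1 = 2 then (1 : L) else 0)) × ↥(UnitaryGroup.arch (↥(maximalRealSubfield L)) L (IsCMField.complexConj L) 1 (Matrix.of fun i j : Fin 1 => if i.val + j.val + 1 = 1 then (1 : L) else 0)))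
    (hell : ∀ w : {w : InfinitePlace L // w.IsComplex},
      ∃ (g₀ : ↥(archLocal L 2 (Matrix.of fun i j : Fin 2 => if i.val + j.val + 1 = 2 then (1 : L) else 0) w)) (l₁ l₂ : ℂ), l₁ ≠ l₂ ∧
        (((archPiEquivCM 2 L (Matrix.of fun i j : Fin 2 => if i.val + j.val + 1 = 2 then (1 : L) else 0) γ.1 w : ↥(archLocal L 2 (Matrix.of fun i j : Fin 2 => if i.val + j.val + 1 = 2 then (1 : L) else 0) w)) : GL (Fin 2) ℂ) : Matrix (Fin 2) (Fin 2) ℂ) =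
          ((g₀ : GL (Fin 2) ℂ) : Matrix (Fin 2) (Fin 2) ℂ) * torusMatrix l₁ l₂ * (((g₀ : GL (Fin 2) ℂ)) : Matrix (Fin 2) (Fin 2) ℂ)⁻¹) :
    ∃ (A : ℝ) (m : ℕ), ∀ R : ℝ, 1 ≤ R →
      νH {y | archHSGL L 3 ((endoEmbArch L (y * γ * y⁻¹)).val : GL (Fin 3) (mixedSpace L)) ≤ R} ≤ ENNReal.ofReal (A * R ^ (1 / (2 : ℝ)) * (1 + Real.log R) ^ m) :=
  haar_setOf_archHSGL_conj_le_of_elliptic L (fun ν _ => haar_unitaryGroupOfForm_antidiag_two_hsBall_le_linear ν) νH γ hell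

end Elliptic

end Literature.NumberTheory.Rogawski1990

end
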